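import Summits.ValiantsHypothesis.ValiantsHypothesis.Theses.ShallowShadows
import Literature.Computability.AlgebraicComplexity.PermanentIrreducible
import Summits.ValiantsHypothesis.ValiantsHypothesis.Theorems.ShadowFormulaTransfer.Negative.FalseOverCharTwo

/-!
# ValiantsHypothesis / ShallowShadows — item `PerShadow` (stmt-ValiantsHypothesis-17128)

The shadow of the permanent is the bipartite perfect matching function: a monomial of
`perPoly (Fin m) ℂ` is a permutation monomial `μ_ρ` (support `{(ρ i, i)}`, `PermanentIrreducible.lean`,
`ShadowFormulaTransfer.Negative.FalseOverCharTwo.mem_support_permMonomial_iff`),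
and `μ_ρ` is supported inside `a` iff `a (i, ρ⁻¹ i) = true` for all `i`, i.e. iff the bipartite graph `a`
has the perfect matching `ρ⁻¹` (`Literature.Barriers.PneNP.perfectMatchingFn`). HONEST FRAMING: a
support lemma of a dormant route; bookkeeping.
-/

-- layout Summits/ValiantsHypothesis/ValiantsHypothesis forces the duplicated namespace component
set_option linter.dupNamespace false

namespace Summit.ValiantsHypothesis.ValiantsHypothesis.Theorems.ShallowShadows

open Literature.Computability.AlgebraicComplexity MvPolynomial

/-- **Item `PerShadow` (stmt-ValiantsHypothesis-17128):** the monomial-support shadow of `per_m`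
inside a Boolean matrix `a` is `perfectMatchingFn m a`. [folklore] -/
theorem perShadow_proof : Theses.ShallowShadows.PerShadow := by
  unfold Theses.ShallowShadows.PerShadow
  intro m a
  rw [Literature.Barriers.PneNP.perfectMatchingFn]
  apply decide_eq_decide.2
  constructor
  · rintro ⟨mo, hmo, ha⟩
    obtain ⟨ρ, rfl⟩ := exists_permMonomial_eq_of_coeff_perPoly_ne_zero ℂ (mem_support_iff.1 hmo)
    refine ⟨ρ.symm, fun i => ha (i, ρ.symm i) ?_⟩
    rw [ShadowFormulaTransfer.Negative.FalseOverCharTwo.mem_support_permMonomial_iff]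
    exact ρ.apply_symm_apply i
  · rintro ⟨σ, hσ⟩
    refine ⟨permMonomial σ.symm, ?_, fun v hv => ?_⟩
    · rw [mem_support_iff, coeff_permMonomial_perPoly]
      exact one_ne_zero
    · rw [ShadowFormulaTransfer.Negative.FalseOverCharTwo.mem_support_permMonomial_iff] at hv
      obtain ⟨r, c⟩ := v
      simp only at hv
      have hc : c = σ r := by rw [← hv, Equiv.apply_symm_apply]
      rw [hc]
      exact hσ r

end Summit.ValiantsHypothesis.ValiantsHypothesis.Theorems.ShallowShadows
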